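import Literature.NumberTheory.Automorphic.SLTwoTreeQuadraticTorusShellCount        -- ★ (W′1) V-b (A-p17 (g23)) p844048: the two-orbit shell count; ⊇ I–V-a
import Literature.NumberTheory.Automorphic.SLTwoTreeQuadraticTorusShellIndexCount   -- ★ (W′1) V-INDEX (A-p01 (g21)) p844066: `relIndex_torusInt_shellStab_eq : [TK : TK(m)] = q^m`, `valuation_det_companion_eq`
import HarnessLib

/-!
# The non-split quadratic torus on the tree of `SL₂(F)`, VI: the EISENSTEIN PACKAGE — `hE` discharged, and Labesse–Langlands' `δ_m = 2q^m` with the shell-sum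
# coefficients `2q^i ∕ 0` under the three Eisenstein hypotheses only (Labesse–Langlands 1979, §2 p. 8)

Topic `NumberTheory/Automorphic`; namespace `Literature.NumberTheory.Automorphic.HermitianLatticeTree` (ROAD W's).  KERNEL mathematics only: theorems, no definition, no
named fact, no instance, no notation, no `sorry`.  Cell `pub/hodgecm-mathlib` (D-0151), crux H413 = `stmt-HodgeConjecture-24833`, line «N6nsGerm», road «W′» = «R1LL-WILD»
(LEAD F0P3a-plan (g10) WORD T9-25; architect A-p16 (g28), RULINGS A-37 FLAG 1 ∕ A-39 (ii) ∕ A-40 (a) ∕ A-44: the Eisenstein shape `(hu : u ∈ 𝒪) (hu1 : |u| < 1) (hv1 : |v| = |ϖ|)`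
is the road's standard for the wildly ramified place, discharged at a CM place by B-p17 (g25)'s ★ (W′1-CM0) `RamifiedPlaceEisensteinBasis.exists_eisenstein_coeffs_of_ramified'`).
Seat A-p17 (g23); parts I–V-b = ★ p843889 ∕ p843931 ∕ p843948 ∕ p843967 ∕ p844025 ∕ p844048, V-INDEX = ★ p844066 (A-p01 (g21)).
HONEST LABEL: HC_CM is proved only modulo the cell's 2 remaining named inputs (hLiu418, h413) until rung 0 closes; nothing printed is asserted here — valuation bookkeeping
over a discrete valuation ring.

THE MATHEMATICS.  In the EISENSTEIN shape (`τ` a uniformiser of `E`: `τ² = uτ + v` with `u ∈ 𝔭`, `|v| = |ϖ|`) the norm form is ULTRAMETRICALLY DIAGONAL: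
**`|p² + p q u − q² v| = max (|p|², |q|²·|ϖ|)`** (§16 `valuation_quadNormForm_eisenstein` — the two pure terms have valuations of opposite parity, the mixed term is
smaller than both), whence the non-split ∕ integral-basis binder `hE` of parts II–V: **`|N(p + qτ)| ≤ 1 ⇒ p, q ∈ 𝒪`** (§16 `quadNormForm_integral_of_eisenstein`; the step
`|q|²|ϖ| ≤ 1 ⇒ |q| ≤ 1` uses the DISCRETENESS of the valuation), and the companion matrix `γτ = (0, v; 1, u)` is itself the ramified `π` of part V-b (`|det γτ| = |v| = |ϖ|`,
★ A-p01 `valuation_det_companion_eq`).  Hence the PACKAGED COUNTS with Eisenstein hypotheses only (§17):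
* **`ncard_setOf_shellIndex_eq_two_mul_pow_of_eisenstein : {x | d x = m}.Finite ∧ {x | d x = m}.ncard = 2 * q ^ m`** (`q = #𝓀_F`; ★ V-b two orbits × ★ V-INDEX
  `q^m`) — Labesse–Langlands' `δ_m = 2q^m`, Labesse 2024 Prop. 0.0.10 `C(ϖ^{−m}) = 2q^m`;
* **`ncard_setOf_glVertexAct_torus_eq_self_sep_shellIndex_of_eisenstein`**: for a unit `γ = a + bτ` with `|b| = |ϖ|^n`, `{x | γ · x = x}` is FINITE (the `hfin` of ★ B-p14
  (g33)'s shell sum p843939 ∕ p844070) and **`#{x | γ · x = x ∧ d x = i} = if i ≤ n then 2 * q ^ i else 0`** (its coefficients).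
NOT here: the transport to the torus of `U(Φ₂)(E_w)` through `ρ_w` ((Ψ1) B-p14 (g33) ∕ B-p08 (g28) ρ-dress), the window algebra ((γ) layer p04 (g14)).

## References
* [LabesseLanglands1979] J.-P. Labesse, R. P. Langlands, *L-indistinguishability for SL(2)*, Canad. J. Math. 31 (1979), §2 p. 8 (`δ_m = 2q^m` if `L` is ramified).
* [Serre1979] J.-P. Serre, *Local Fields* (1979), Ch. I §6 (Eisenstein polynomials, totally ramified extensions: `𝒪_E = 𝒪_F[τ]`).
* [Serre1980Trees] J.-P. Serre, *Trees* (1980), Ch. II §1.1.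
-/

set_option autoImplicit false

noncomputable section

open scoped ValuativeRel Matrix MatrixGroups
open Matrix ValuativeRel

namespace Literature.NumberTheory.Automorphic.HermitianLatticeTree

open Literature.NumberTheory.Automorphic Literature.NumberTheory.LocalFields

variable {F : Type*} [Field F] [ValuativeRel F] {ϖ : F} (hϖ : IsUniformizingElement ϖ) [IsDiscreteValuationRing 𝒪[F]]

/-! ## §16 The Eisenstein norm form is ultrametrically diagonal; `hE` -/

include hϖ in
omit [IsDiscreteValuationRing 𝒪[F]] in
/-- An integral element of valuation `< 1` has valuation `≤ |ϖ|` (it is a multiple of `ϖ`; ★ `IsUniformizingElement.exists_eq_mul`). [cite: Serre1979, Ch. I §6] -/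
theorem valuation_le_valuation_uniformizer_of_lt_one {u : F} (hu : u ∈ 𝒪[F]) (hu1 : valuation F u < 1) : valuation F u ≤ valuation F ϖ := by
  obtain ⟨y, hy, rfl⟩ := hϖ.exists_eq_mul hu hu1
  rw [map_mul]
  exact mul_le_of_le_one_right zero_le ((Valuation.mem_integer_iff _ _).1 hy)

include hϖ in
/-- **THE EISENSTEIN NORM FORM IS ULTRAMETRICALLY DIAGONAL**: for `u ∈ 𝒪` with `|u| < 1` and `|v| = |ϖ|`, `|p² + p q u − q² v| = max (|p|², |q|² |ϖ|)` — the pure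
terms have valuations `|ϖ|^{2a}` and `|ϖ|^{2b+1}` of opposite parity (never equal unless both vanish) and the mixed term `|pqu| ≤ |ϖ|^{a+b+1}` is strictly below their
maximum. [cite: Serre1979, Ch. I §6] [cite: LabesseLanglands1979, §2 p. 8] -/
theorem valuation_quadNormForm_eisenstein {u v : F} (hu : u ∈ 𝒪[F]) (hu1 : valuation F u < 1) (hv1 : valuation F v = valuation F ϖ) (p q : F) :
    valuation F (p ^ 2 + p * q * u - q ^ 2 * v) = max (valuation F p ^ 2) (valuation F q ^ 2 * valuation F ϖ) := by
  have h0 := hϖ.ne_zero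
  have hϖpos : 0 < valuation F ϖ := (Valuation.pos_iff _).2 h0
  have hϖ1 := hϖ.valuation_lt_one
  have huϖ := valuation_le_valuation_uniformizer_of_lt_one hϖ hu hu1
  -- the three terms
  have hP : valuation F (p ^ 2) = valuation F p ^ 2 := map_pow _ _ _
  have hQ : valuation F (-(q ^ 2 * v)) = valuation F q ^ 2 * valuation F ϖ := by rw [Valuation.map_neg, map_mul, map_pow, hv1]
  have hM : valuation F (p * q * u) ≤ valuation F p * valuation F q * valuation F ϖ := by
    rw [map_mul, map_mul]; exact mul_le_mul_right huϖ _
  by_cases hp : p = 0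
  · subst hp
    by_cases hq : q = 0
    · subst hq; simp
    · have : (0 : F) ^ 2 + 0 * q * u - q ^ 2 * v = -(q ^ 2 * v) := by ring
      rw [this, hQ, map_zero, zero_pow two_ne_zero, max_eq_right zero_le]
  by_cases hq : q = 0
  · subst hq
    have : p ^ 2 + p * 0 * u - (0 : F) ^ 2 * v = p ^ 2 := by ring
    rw [this, hP, map_zero, zero_pow two_ne_zero, zero_mul, max_eq_left zero_le]
  -- `|p| = |ϖ|^a`, `|q| = |ϖ|^b`
  obtain ⟨a, wa, hwa, hpa⟩ := exists_eq_zpow_mul_of_ne_zero hϖ hp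
  obtain ⟨b, wb, hwb, hqb⟩ := exists_eq_zpow_mul_of_ne_zero hϖ hq
  have hvp : valuation F p = valuation F ϖ ^ a := by rw [hpa, map_mul, map_zpow₀, hwa, mul_one]
  have hvq : valuation F q = valuation F ϖ ^ b := by rw [hqb, map_mul, map_zpow₀, hwb, mul_one]
  have hv0 : valuation F ϖ ≠ 0 := hϖpos.ne'
  have hPz : valuation F p ^ 2 = valuation F ϖ ^ (2 * a) := by rw [hvp, ← zpow_natCast, ← _root_.zpow_mul]; congr 1; ring
  have hQz : valuation F q ^ 2 * valuation F ϖ = valuation F ϖ ^ (2 * b + 1) := by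
    rw [hvq, ← zpow_natCast, ← _root_.zpow_mul, zpow_add_one₀ hv0]; congr 2; ring
  have hMz : valuation F p * valuation F q * valuation F ϖ = valuation F ϖ ^ (a + b + 1) := by
    rw [hvp, hvq, ← zpow_add₀ hv0, zpow_add_one₀ hv0]
  -- strict comparison of powers of `|ϖ| < 1`
  have hlt : ∀ i j : ℤ, j < i → valuation F ϖ ^ i < valuation F ϖ ^ j := fun i j hij => zpow_lt_zpow_right_of_lt_one₀ hϖpos hϖ1 hij
  rcases le_or_gt a b with hab | hab
  · -- `|p|² = |ϖ|^{2a}` dominates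
    have hQlt : valuation F (-(q ^ 2 * v)) < valuation F (p ^ 2) := by rw [hQ, hP, hPz, hQz]; exact hlt _ _ (by omega)
    have hMlt : valuation F (p * q * u) < valuation F (p ^ 2) := lt_of_le_of_lt hM (by rw [hP, hPz, hMz]; exact hlt _ _ (by omega))
    have hsum : valuation F (p ^ 2 + p * q * u - q ^ 2 * v) = valuation F (p ^ 2) := by
      rw [show p ^ 2 + p * q * u - q ^ 2 * v = p ^ 2 + (p * q * u + -(q ^ 2 * v)) by ring]
      exact Valuation.map_add_eq_of_lt_left _ (lt_of_le_of_lt (Valuation.map_add _ _ _) (max_lt hMlt hQlt))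
    rw [hsum, hP, max_eq_left]
    rw [← hP, ← hQ]; exact hQlt.le
  · -- `|q|²|ϖ| = |ϖ|^{2b+1}` dominates
    have hPlt : valuation F (p ^ 2) < valuation F (-(q ^ 2 * v)) := by rw [hQ, hP, hPz, hQz]; exact hlt _ _ (by omega)
    have hMlt : valuation F (p * q * u) < valuation F (-(q ^ 2 * v)) := lt_of_le_of_lt hM (by rw [hQ, hQz, hMz]; exact hlt _ _ (by omega))
    have hsum : valuation F (p ^ 2 + p * q * u - q ^ 2 * v) = valuation F (-(q ^ 2 * v)) := by
      rw [show p ^ 2 + p * q * u - q ^ 2 * v = -(q ^ 2 * v) + (p ^ 2 + p * q * u) by ring]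
      exact Valuation.map_add_eq_of_lt_left _ (lt_of_le_of_lt (Valuation.map_add _ _ _) (max_lt hPlt hMlt))
    rw [hsum, hQ, max_eq_right]
    rw [← hP, ← hQ]; exact hPlt.le

include hϖ in
/-- **EISENSTEIN ⇒ `hE` (the non-split ∕ integral-basis binder of parts II–V)**: `|p² + p q u − q² v| ≤ 1 ⇒ p, q ∈ 𝒪` — `|p|² ≤ 1` gives `|p| ≤ 1`, and `|q|²·|ϖ| ≤ 1` gives
`|q| ≤ 1` because the valuation is DISCRETE (`|q| = |ϖ|^b` with `2b + 1 ≥ 0` forces `b ≥ 0`). [cite: Serre1979, Ch. I §6] [cite: LabesseLanglands1979, §2 p. 8] -/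
theorem quadNormForm_integral_of_eisenstein {u v : F} (hu : u ∈ 𝒪[F]) (hu1 : valuation F u < 1) (hv1 : valuation F v = valuation F ϖ) :
    ∀ p q : F, valuation F (p ^ 2 + p * q * u - q ^ 2 * v) ≤ 1 → p ∈ 𝒪[F] ∧ q ∈ 𝒪[F] := by
  intro p q hN
  have hϖpos : 0 < valuation F ϖ := (Valuation.pos_iff _).2 hϖ.ne_zero
  have hv0 : valuation F ϖ ≠ 0 := hϖpos.ne'
  rw [valuation_quadNormForm_eisenstein hϖ hu hu1 hv1, max_le_iff] at hN
  refine ⟨?_, ?_⟩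
  · rw [Valuation.mem_integer_iff]
    exact (pow_le_one_iff_of_nonneg zero_le two_ne_zero).1 hN.1
  · by_cases hq : q = 0
    · rw [hq]; exact zero_mem _
    obtain ⟨b, wb, hwb, hqb⟩ := exists_eq_zpow_mul_of_ne_zero hϖ hq
    have hvq : valuation F q = valuation F ϖ ^ b := by rw [hqb, map_mul, map_zpow₀, hwb, mul_one]
    have h2 : valuation F ϖ ^ (2 * b + 1) ≤ valuation F ϖ ^ (0 : ℤ) := by
      have h := hN.2
      rw [hvq, ← zpow_natCast, ← _root_.zpow_mul, ← zpow_add_one₀ hv0, show b * ((2 : ℕ) : ℤ) + 1 = 2 * b + 1 by push_cast; ring] at h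
      rwa [zpow_zero]
    have hb : 0 ≤ b := by
      have := (zpow_le_zpow_iff_right_of_lt_one₀ hϖpos hϖ.valuation_lt_one).1 h2
      omega
    rw [Valuation.mem_integer_iff, hvq]
    exact zpow_le_one₀ hϖpos hϖ.valuation_le_one hb

/-! ## §17 The packaged counts: `δ_m = 2q^m` and the shell-sum coefficients, Eisenstein hypotheses only -/

include hϖ in
omit [IsDiscreteValuationRing 𝒪[F]] in
/-- In the Eisenstein shape `v ∈ 𝒪` (`|v| = |ϖ| ≤ 1`). [cite: Serre1979, Ch. I §6] -/
theorem mem_integer_of_valuation_eq_uniformizer {v : F} (hv1 : valuation F v = valuation F ϖ) : v ∈ 𝒪[F] := by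
  rw [Valuation.mem_integer_iff, hv1]; exact hϖ.valuation_le_one

omit [ValuativeRel F] [IsDiscreteValuationRing 𝒪[F]] in
/-- The companion matrix lies in its own centraliser (it is the ramified `π` of part V-b: `|det γτ| = |v| = |ϖ|`, ★ `valuation_det_companion_eq`). [cite: Serre1980Trees, Ch. II §1.3] -/
theorem companion_mem_centralizer (γτ : GL (Fin 2) F) : γτ ∈ Subgroup.centralizer ({γτ} : Set (GL (Fin 2) F)) :=
  Subgroup.mem_centralizer_singleton_iff.2 rfl

include hϖ in
/-- **LABESSE–LANGLANDS' `δ_m = 2q^m`** (Eisenstein hypotheses only): in the Eisenstein shape (`u ∈ 𝒪`, `|u| < 1`, `|v| = |ϖ|` — a RAMIFIED place, any residue characteristic)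
over a DVR with finite residue field of cardinality `q`, the shell `{x | d x = m}` of the tree of `SL₂(F)` about the facet of the torus `F[τ]^×` is FINITE and has EXACTLY
**`2 · q^m`** vertices (★ V-b two orbits `TK·x_m ⊔ γτ·(TK·x_m)` × ★ V-INDEX `[TK : TK(m)] = q^m`). [cite: LabesseLanglands1979, §2 p. 8] -/
theorem ncard_setOf_shellIndex_eq_two_mul_pow_of_eisenstein [Finite (IsLocalRing.ResidueField 𝒪[F])] {u v : F} (hu : u ∈ 𝒪[F]) (hu1 : valuation F u < 1)
    (hv1 : valuation F v = valuation F ϖ) {γτ : GL (Fin 2) F} (hγτ : (γτ : Matrix (Fin 2) (Fin 2) F) = !![0, v; 1, u])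
    {r : ℕ → GL (Fin 2) F} (hr : ∀ m, (r m : Matrix (Fin 2) (Fin 2) F) = Matrix.diagonal ![1, ϖ ^ m])
    (v₀ : {M : Submodule 𝒪[F] (Fin 2 → F) // IsSpecialLattice (RingHom.id F) ϖ !![(0 : F), 1; -1, 0] M})
    (hv₀ : v₀.1 = latt (1 : Matrix (Fin 2) (Fin 2) F))
    {d : {M : Submodule 𝒪[F] (Fin 2 → F) // IsSpecialLattice (RingHom.id F) ϖ !![(0 : F), 1; -1, 0] M} → ℕ}
    (hd : ∀ x, ∃ (t gm : GL (Fin 2) F) (c e : F), (t : Matrix (Fin 2) (Fin 2) F) = !![c, e * v; e, c + e * u] ∧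
      (gm : Matrix (Fin 2) (Fin 2) F) = Matrix.diagonal ![1, ϖ ^ d x] ∧ x = glVertexAct hϖ (t * gm) v₀)
    (hd' : ∀ (x) (t gm : GL (Fin 2) F) (c e : F) (m : ℕ), (t : Matrix (Fin 2) (Fin 2) F) = !![c, e * v; e, c + e * u] →
      (gm : Matrix (Fin 2) (Fin 2) F) = Matrix.diagonal ![1, ϖ ^ m] → x = glVertexAct hϖ (t * gm) v₀ → d x = m) (m : ℕ) :
    {x | d x = m}.Finite ∧ {x | d x = m}.ncard = 2 * Nat.card (IsLocalRing.ResidueField 𝒪[F]) ^ m := by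
  have hidx := relIndex_torusInt_shellStab_eq hϖ hu hu1 hv1 hγτ (hr m)
  have hq : Nat.card (IsLocalRing.ResidueField 𝒪[F]) ^ m ≠ 0 := pow_ne_zero m Nat.card_pos.ne'
  have h := ncard_setOf_shellIndex_eq_two_mul_relIndex hϖ hu (mem_integer_of_valuation_eq_uniformizer hϖ hv1) (quadNormForm_integral_of_eisenstein hϖ hu hu1 hv1)
    hγτ (companion_mem_centralizer γτ) (valuation_det_companion_eq hv1 hγτ) hr v₀ hv₀ hd hd' m (by rw [hidx]; exact hq)
  rw [hidx] at h
  exact h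

include hϖ in
/-- **THE SHELL-SUM COEFFICIENTS AND `hfin`, Eisenstein hypotheses only** (the (W′1)-side inputs of ★ B-p14 (g33)'s `FixedPointsShellValueLaw` ∕ `RankOneKappaOrbitalUnfoldingTree`):
for a unit `γ = (a, bv; b, a+bu)` of the order (`a b ∈ 𝒪`, `|det γ| = 1`) with `|b| = |ϖ|^n`, the fixed set `{x | γ · x = x}` is FINITE and
**`#{x | γ · x = x ∧ d x = i} = if i ≤ n then 2 * q ^ i else 0`**. [cite: LabesseLanglands1979, §2 p. 8] -/
theorem ncard_setOf_glVertexAct_torus_eq_self_sep_shellIndex_of_eisenstein [Finite (IsLocalRing.ResidueField 𝒪[F])] {u v a b : F} (hu : u ∈ 𝒪[F])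
    (hu1 : valuation F u < 1) (hv1 : valuation F v = valuation F ϖ) (ha : a ∈ 𝒪[F]) (hb : b ∈ 𝒪[F]) {n : ℕ} (hbn : valuation F b = valuation F ϖ ^ n)
    {γ : GL (Fin 2) F} (hγ : (γ : Matrix (Fin 2) (Fin 2) F) = !![a, b * v; b, a + b * u]) (hγdet : valuation F (γ : Matrix (Fin 2) (Fin 2) F).det = 1)
    {γτ : GL (Fin 2) F} (hγτ : (γτ : Matrix (Fin 2) (Fin 2) F) = !![0, v; 1, u])
    {r : ℕ → GL (Fin 2) F} (hr : ∀ m, (r m : Matrix (Fin 2) (Fin 2) F) = Matrix.diagonal ![1, ϖ ^ m])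
    (v₀ : {M : Submodule 𝒪[F] (Fin 2 → F) // IsSpecialLattice (RingHom.id F) ϖ !![(0 : F), 1; -1, 0] M})
    (hv₀ : v₀.1 = latt (1 : Matrix (Fin 2) (Fin 2) F))
    {d : {M : Submodule 𝒪[F] (Fin 2 → F) // IsSpecialLattice (RingHom.id F) ϖ !![(0 : F), 1; -1, 0] M} → ℕ}
    (hd : ∀ x, ∃ (t gm : GL (Fin 2) F) (c e : F), (t : Matrix (Fin 2) (Fin 2) F) = !![c, e * v; e, c + e * u] ∧
      (gm : Matrix (Fin 2) (Fin 2) F) = Matrix.diagonal ![1, ϖ ^ d x] ∧ x = glVertexAct hϖ (t * gm) v₀)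
    (hd' : ∀ (x) (t gm : GL (Fin 2) F) (c e : F) (m : ℕ), (t : Matrix (Fin 2) (Fin 2) F) = !![c, e * v; e, c + e * u] →
      (gm : Matrix (Fin 2) (Fin 2) F) = Matrix.diagonal ![1, ϖ ^ m] → x = glVertexAct hϖ (t * gm) v₀ → d x = m) :
    {x | glVertexAct hϖ γ x = x}.Finite ∧
      ∀ i, {x | glVertexAct hϖ γ x = x ∧ d x = i}.ncard = if i ≤ n then 2 * Nat.card (IsLocalRing.ResidueField 𝒪[F]) ^ i else 0 := by
  have hq : ∀ i, Nat.card (IsLocalRing.ResidueField 𝒪[F]) ^ i ≠ 0 := fun i => pow_ne_zero i Nat.card_pos.ne'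
  have hidx : ∀ i, ((Subgroup.centralizer ({γτ} : Set (GL (Fin 2) F)) ⊓ glInt 2 F) ⊓ (glInt 2 F).map (MulAut.conj (r i)).toMonoidHom).relIndex
      (Subgroup.centralizer ({γτ} : Set (GL (Fin 2) F)) ⊓ glInt 2 F) = Nat.card (IsLocalRing.ResidueField 𝒪[F]) ^ i :=
    fun i => relIndex_torusInt_shellStab_eq hϖ hu hu1 hv1 hγτ (hr i)
  obtain ⟨hfin, hcoef⟩ := ncard_setOf_glVertexAct_torus_eq_self_sep_shellIndex hϖ hu (mem_integer_of_valuation_eq_uniformizer hϖ hv1) ha hb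
    (quadNormForm_integral_of_eisenstein hϖ hu hu1 hv1) hbn hγ hγdet hγτ (companion_mem_centralizer γτ) (valuation_det_companion_eq hv1 hγτ) hr v₀ hv₀ hd hd'
    (fun i _ => by rw [hidx i]; exact hq i)
  refine ⟨hfin, fun i => ?_⟩
  rw [hcoef i, hidx i]

end Literature.NumberTheory.Automorphic.HermitianLatticeTree

end
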